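import Mathlib
import Summits.MatrixMultiplication.MatrixMultiplication.Theorems.FourierTwoFamiliesModPPrimeTwoFamiliesCapacityLift

/-!
# The self-converse lift is the `L = 2` code lift (support file, Mathlib-API route)

Item `stmt-MatrixMultiplication-14308` (`FourierTwoFamiliesModP.PrimeTwoFamilies`, CKSU 2005 Conj. 4.7 with
prime cyclic hosts), line `Sketch` (capacity-gadget form), registered stub `selfConverseLift`.

The module docstring of `…Theorems.PrimeTwoFamilies.CapacityLift` asserts that the self-converse lift (the
`r` blocks `(P σ ×ˢ P (π σ), Q σ ×ˢ Q (π σ))` in `K × K`) is the word-length-two instance of the general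
zero-error CODE LIFT `CapacityLift.codeLift` (product blocks over a code `W ⊆ (Fin L → Fin r)`), and then
proves the two lifts independently.  This file makes the reduction itself formal: `selfConverseLift` below
(same name and signature as the registered stub, in its own namespace) is DERIVED from `codeLift` at `L = 2`
with the code of graph words `W = {![σ, π σ] : σ < r}`, transported along Mathlib's linear identification
`(LinearEquiv.finTwoArrow ℤ K).symm : K × K ≃ₗ[ℤ] (Fin 2 → K)`, `x ↦ ![x.1, x.2]`:

* the relation `(a - a') + (b - b') = 0` is pushed through the equivalence by `map_sub` / `map_add` /
  `map_zero`, and block equalities are pulled back by injectivity;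
* block membership `P σ ×ˢ P (π σ)` ↔ `Fintype.piFinset (fun t => P (![σ, π σ] t))` is
  `Finset.mem_product` + `Fintype.mem_piFinset` + `Fin.forall_fin_two`;
* the hypothesis "every ordered pair of distinct letters is strongly separated directly or after `π`" is
  exactly the zero-error-code hypothesis of `codeLift` for `W`, the separating coordinate being `0` or `1`.

Nothing else is proved here (siege discipline: one stub, verbatim).
-/

-- single-conjunct summit: the mandated namespace repeats `MatrixMultiplication` (summit = sub-problem).
set_option linter.dupNamespace false

namespace Summit.MatrixMultiplication.MatrixMultiplication.Theorems.PrimeTwoFamilies.SiegeK21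

open Finset

/-- **SELF-CONVERSE LIFT** as the `L = 2` instance of `CapacityLift.codeLift`.  If every letter
`(P c, Q c)` is direct (`hD`) and a map `π` on the letters strongly separates every ordered pair of distinct
letters either directly or after `π` (`hπ`), then the `r` blocks `(P σ ×ˢ P (π σ), Q σ ×ˢ Q (π σ))` in
`K × K` satisfy clause (W) (first conjunct) and clause (X) (second conjunct) of the simultaneous double
product property.  Proof: apply `codeLift` to the code of graph words `![σ, π σ]` and transport along
`(LinearEquiv.finTwoArrow ℤ K).symm`. -/
theorem selfConverseLift {K : Type*} [AddCommGroup K] [DecidableEq K] {r : ℕ}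
    (P Q : Fin r → Finset K)
    (hD : ∀ c : Fin r, ∀ x ∈ P c, ∀ x' ∈ P c, ∀ y ∈ Q c, ∀ y' ∈ Q c,
      (x - x') + (y - y') = 0 → x = x' ∧ y = y')
    (π : Fin r → Fin r)
    (hπ : ∀ σ τ : Fin r, σ ≠ τ →
      (∀ p ∈ P σ, ∀ q ∈ Q τ, ∀ c : Fin r, ∀ p' ∈ P c, ∀ q' ∈ Q c, q - p ≠ q' - p') ∨
      (∀ p ∈ P (π σ), ∀ q ∈ Q (π τ), ∀ c : Fin r, ∀ p' ∈ P c, ∀ q' ∈ Q c, q - p ≠ q' - p')) :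
    (∀ σ : Fin r, ∀ a ∈ P σ ×ˢ P (π σ), ∀ a' ∈ P σ ×ˢ P (π σ),
      ∀ b ∈ Q σ ×ˢ Q (π σ), ∀ b' ∈ Q σ ×ˢ Q (π σ),
        (a - a') + (b - b') = 0 → a = a' ∧ b = b') ∧
    (∀ i j k : Fin r, ∀ a ∈ P i ×ˢ P (π i), ∀ a' ∈ P j ×ˢ P (π j),
      ∀ b ∈ Q j ×ˢ Q (π j), ∀ b' ∈ Q k ×ˢ Q (π k),
        (a - a') + (b - b') = 0 → i = k) := by
  -- Mathlib's identification `K × K ≃ₗ[ℤ] (Fin 2 → K)`, `x ↦ ![x.1, x.2]`.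
  set e : (K × K) ≃ₗ[ℤ] (Fin 2 → K) := (LinearEquiv.finTwoArrow ℤ K).symm with he
  -- The graph words of `π` (the `L = 2` code).
  set w : Fin r → Fin 2 → Fin r := fun σ => ![σ, π σ] with hw
  have hw0 : ∀ σ, w σ 0 = σ := fun σ => by simp [hw]
  have hw1 : ∀ σ, w σ 1 = π σ := fun σ => by simp [hw]
  have hwW : ∀ σ, w σ ∈ (univ : Finset (Fin r)).image w := fun σ =>
    mem_image_of_mem w (mem_univ σ)
  -- `hπ` is the zero-error-code hypothesis of `codeLift` for the graph words.
  have code : ∀ u ∈ (univ : Finset (Fin r)).image w, ∀ v ∈ (univ : Finset (Fin r)).image w, u ≠ v →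
      ∃ t : Fin 2, ∀ p ∈ P (u t), ∀ q ∈ Q (v t), ∀ c : Fin r, ∀ p' ∈ P c, ∀ q' ∈ Q c,
        q - p ≠ q' - p' := by
    intro u hu v hv huv
    simp only [mem_image, mem_univ, true_and] at hu hv
    obtain ⟨σ, rfl⟩ := hu
    obtain ⟨τ, rfl⟩ := hv
    have hστ : σ ≠ τ := fun h => huv (by rw [h])
    rcases hπ σ τ hστ with h | h
    · exact ⟨0, by rw [hw0, hw0]; exact h⟩
    · exact ⟨1, by rw [hw1, hw1]; exact h⟩
  obtain ⟨hWc, hXc⟩ := CapacityLift.codeLift P Q hD ((univ : Finset (Fin r)).image w) code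
  -- block membership transports along `e`
  have mem : ∀ (F : Fin r → Finset K) (σ : Fin r) (x : K × K), x ∈ F σ ×ˢ F (π σ) →
      e x ∈ Fintype.piFinset (fun t => F (w σ t)) := by
    intro F σ x hx
    rw [mem_product] at hx
    rw [Fintype.mem_piFinset, Fin.forall_fin_two, hw0, hw1]
    simpa [he] using hx
  -- the defining relation transports along `e`
  have rel : ∀ a a' b b' : K × K, (a - a') + (b - b') = 0 →
      (e a - e a') + (e b - e b') = 0 := by
    intro a a' b b' h
    rw [← map_sub, ← map_sub, ← map_add, h, map_zero]
  refine ⟨?_, ?_⟩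
  · -- (W): pull back through the injective `e`
    intro σ a ha a' ha' b hb b' hb' h
    obtain ⟨h1, h2⟩ := hWc (w σ) (hwW σ) (e a) (mem P σ a ha) (e a') (mem P σ a' ha')
      (e b) (mem Q σ b hb) (e b') (mem Q σ b' hb') (rel a a' b b' h)
    exact ⟨e.injective h1, e.injective h2⟩
  · -- (X): equal graph words have equal first letters
    intro i j k a ha a' ha' b hb b' hb' h
    have hik : w i = w k := hXc (w i) (hwW i) (w j) (hwW j) (w k) (hwW k) (e a) (mem P i a ha)
      (e a') (mem P j a' ha') (e b) (mem Q j b hb) (e b') (mem Q k b' hb') (rel a a' b b' h)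
    rw [← hw0 i, ← hw0 k, hik]

end Summit.MatrixMultiplication.MatrixMultiplication.Theorems.PrimeTwoFamilies.SiegeK21
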